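import Literature.ModelTheory.ExponentialFields.CodeNewtonLetters
import Literature.ModelTheory.ExponentialFields.ExpPolyCodeLawful
import Literature.ModelTheory.ExponentialFields.LinearDependenceReduction
import Literature.ModelTheory.ExponentialFields.Desingularisation
import Literature.ModelTheory.ExponentialFields.PointIdealGeneratorsProofs
import Literature.ModelTheory.ExponentialFields.ExistentialReductionOEF
import Literature.ModelTheory.ExponentialFields.MacintyreWilkieREAxioms
import HarnessLib

/-!
# The conditional half of Macintyre–Wilkie's theorem, assembled from its leaves

Family `periods` (periods.S27), topic `Literature/ModelTheory/ExponentialFields`.  Node (B) of the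
decomposition of `Literature.ModelTheory.ExponentialFields.macintyre_wilkie`
(`SchanuelProperty ℝ → RealExpDecidable`): the implication

  `SC_ℝ ⟹ Th_∃(ℝ_exp)` is recursively enumerable
  (`Literature.ModelTheory.ExponentialFields.macintyreWilkie_existential_of_schanuelProperty`),

proved here from three named leaves, following Macintyre–Wilkie 1996 §5 in the rendering of
Jones–Servi 2011, §3 (there for `x^α`; here for `exp`):

* (B2) `Wilkie1996_flatDesingularisation` (`Desingularisation.lean`, named fact): zero sets of
  flat integer exponential polynomials contain non-singular zeros of square flat systems;
* (B3) `JonesServi2011_pointIdealGenerators` (`PointIdealGenerators.lean`, named fact =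
  Jones–Servi Prop. 3.8 at the point `(ā, e^{ā})`; **proved** in `PointIdealGeneratorsProofs.lean`): after inverting some `q₀` non-vanishing at the point, the ideal of
  `(ā, e^{ā})` in `ℤ[x̄, ȳ]` is generated by `2N − trdeg ℚ(ā, e^{ā})` polynomials;
* (B4) `ExpPolyCode.newtonScheme_isREAxioms` (`CodeNewtonLetters.lean`, proved): the scheme of
  code Newton sentences is r.e.

Everything else is proved in the tree: the recursive true theory `OEF` and its models
(`OrderedExpFieldModels.lean`), the reduction of existential sentences to one flat equation
uniformly in the models of `OEF` ((B5), `ExistentialReductionOEF.lean`), the Newton–Kantorovich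
scheme and the transfer of non-singular zeros to all models ((B7), `NewtonSentences.lean`,
`NewtonTransfer.lean`, `CodeNewtonSentences.lean`), the auxiliary system
`H = (M, x_{N+1} p₀ − 1)` ((B3.4), `AuxiliarySystem.lean`, `ExpPolyJacobian.lean`), the
elimination of integer linear relations of the zero (`LinearDependenceReduction.lean`), and the
r.e. bookkeeping (`MacintyreWilkieREAxioms.lean`).

## Main statements

* `mwTheory = OEF ∪ newtonScheme` (true, and recursive ∪ r.e.);
* `exists_zero_in_models`: under SC, (B2), (B3): every flat `P ∈ ℤ[x̄, ȳ]` with a real zero of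
  `x̄ ↦ P(x̄, e^{x̄})` has a zero `P(γ̄, exp γ̄) = 0` in every model of `mwTheory` — by induction on
  the number of variables: at an exponentially-algebraic zero with `ℚ`-linearly independent
  coordinates, SC and (B3) give the identities `p₀ P, p₀ fᵢ ∈ (M₁, …, M_N)`, the auxiliary system
  is non-singular at `(ā, p₀(ā)⁻¹)`, the Newton scheme moves its zero to the model, and the
  identity kills `P` there; at a linearly dependent zero one variable is eliminated;
* `mwTheory_models_of_mem`: hence `mwTheory ⊨ φ` for every `φ ∈ Th_∃(ℝ_exp)` ((B5) both ways);
* **`macintyreWilkie_existential_of_leaves`**: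
  `(B2) → (B3) → (B4) → macintyreWilkie_existential_of_schanuelProperty`, and with (B4) proved,
  **`macintyreWilkie_existential_of_facts`**: `(B2) → (B3) → macintyreWilkie_existential_of_schanuelProperty`
  — the conditional half of Macintyre–Wilkie's Theorem 1.1 from two cited named facts — and with
  (B3) proved as well, **`macintyreWilkie_existential_of_desingularisation`**:
  `Wilkie1996_flatDesingularisation → macintyreWilkie_existential_of_schanuelProperty`;
* **`macintyre_wilkie_of_leaves`**, **`macintyre_wilkie_of_facts`**: with the unconditional half
  `macintyreWilkie_recursiveSubtheory` (A0) as a further hypothesis, `macintyre_wilkie`.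

## References

* A. Macintyre, A. J. Wilkie, *On the decidability of the real exponential field*, in:
  Kreiseliana, A K Peters (1996), 441–467, §5.
* G. O. Jones, T. Servi, *On the decidability of the real field with a generic power function*,
  J. Symb. Log. 76 (2011), Prop. 3.8, Thm. 3.11 (proof).
-/

noncomputable section

open scoped BigOperators Matrix
open FirstOrder FirstOrder.Language MvPolynomial

namespace Literature.ModelTheory.ExponentialFields

open ExpPoly ExpPolyCode

/-! ### The theory `OEF ∪ NewtonScheme` -/

/-- **The recursive-plus-r.e. true theory of the decision procedure**: the finite theory `OEF` of
ordered exponential fields together with the scheme of all code Newton sentences. [folklore] -/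
def mwTheory : Language.orderedExpRing.Theory :=
  Theory.OEF ∪ newtonScheme

/-- `mwTheory` proves `OEF`. [folklore] -/
theorem modelsOEF_mwTheory : Theory.ModelsOEF mwTheory :=
  modelsOEF_of_subset Set.subset_union_left

/-- `mwTheory ⊆ Th(ℝ_exp)`. [folklore] -/
theorem mwTheory_subset_realExpTheory : mwTheory ⊆ realExpTheory :=
  Set.union_subset OEF_subset_realExpTheory newtonScheme_subset_realExpTheory

/-- `mwTheory` proves every code Newton sentence. [folklore] -/
theorem mwTheory_models_codeNewtonSentence (n : ℕ) (F : List ExpPolyCode) :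
    mwTheory ⊨ᵇ codeNewtonSentence n F :=
  Language.Theory.models_sentence_of_mem (Set.mem_union_right _ (codeNewtonSentence_mem_newtonScheme n F))

/-- The exponential of an `OEF`-model, as the interpretation `NewtonExp.expM` of the symbol. [folklore] -/
theorem expM_eq_exp (K : Language.Theory.ModelType.{0, 0, 0} Theory.OEF) :
    NewtonExp.expM K = OEFModel.exp := rfl

/-! ### Integer relations from rational dependence -/

/-- A `ℚ`-linearly dependent real tuple satisfies a non-trivial **integer** relation. [folklore] -/
theorem exists_int_rel_of_not_linearIndependent {n : ℕ} {a : Fin n → ℝ} (h : ¬ LinearIndependent ℚ a) :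
    ∃ b : Fin n → ℤ, b ≠ 0 ∧ ∑ i, (b i : ℝ) * a i = 0 := by
  classical
  obtain ⟨g, hg, i₀, hi₀⟩ := Fintype.not_linearIndependent_iff.1 h
  -- clear denominators: `D = ∏ den`, `b i = g i * D ∈ ℤ`
  set D : ℕ := ∏ j, (g j).den with hD
  have hDpos : 0 < D := Finset.prod_pos fun j _ => (g j).den_pos
  have hint : ∀ i, ∃ z : ℤ, (g i * D : ℚ) = z := by
    intro i
    have hdvd : (g i).den ∣ D := Finset.dvd_prod_of_mem _ (Finset.mem_univ i)
    obtain ⟨e, he⟩ := hdvd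
    refine ⟨(g i).num * e, ?_⟩
    rw [he, Nat.cast_mul, ← mul_assoc, Rat.mul_den_eq_num]
    push_cast
    ring
  choose b hb using hint
  refine ⟨b, fun hb0 => hi₀ ?_, ?_⟩
  · have : (g i₀ * D : ℚ) = 0 := by rw [hb i₀, hb0]; simp
    rcases mul_eq_zero.1 this with h | h
    · exact h
    · exact absurd (by exact_mod_cast h) hDpos.ne'
  · have hsum : ∑ i, (g i : ℝ) * a i = 0 := by
      simpa [Rat.smul_def, Algebra.smul_def] using hg
    have : ∀ i, (b i : ℝ) = (g i : ℝ) * D := fun i => by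
      have := hb i
      have : ((b i : ℚ) : ℝ) = ((g i * D : ℚ) : ℝ) := by rw [this]
      push_cast at this
      exact this
    calc ∑ i, (b i : ℝ) * a i = (D : ℝ) * ∑ i, (g i : ℝ) * a i := by
          rw [Finset.mul_sum]; exact Finset.sum_congr rfl fun i _ => by rw [this i]; ring
      _ = 0 := by rw [hsum, mul_zero]

/-! ### Eliminating one variable at a dependent zero -/

/-- **One variable fewer at a linearly dependent zero**: from a real zero `ā` of
`x̄ ↦ P(x̄, e^{x̄})` (`N + 1` variables) with a non-trivial integer relation `Σ bᵢ aᵢ = 0`, a flat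
`P'` in `N` variables with a real zero such that, in every field with an exponential-like `E`,
zeros of `P'` give zeros of `P` (`LinearDependenceReduction.lean`: `zeroPoly` when a single
`bᵢ ≠ 0`, otherwise `flipPoly` if needed and `substPoly` along `relMatrix`). [cite: JonesServi2011, Thm. 3.11 (proof, first reduction)] -/
theorem reduce_dependent {N : ℕ} (P : MvPolynomial (Fin (N + 1) ⊕ Fin (N + 1)) ℤ)
    {a : Fin (N + 1) → ℝ} (ha : expEval P a = 0) {b : Fin (N + 1) → ℤ} (hb : b ≠ 0)
    (hrel : ∑ i, (b i : ℝ) * a i = 0) :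
    ∃ P' : MvPolynomial (Fin N ⊕ Fin N) ℤ, (∃ a' : Fin N → ℝ, expEval P' a' = 0) ∧
      ∀ {K : Type} [Field K] {E : K → K}, (∀ x y, E (x + y) = E x * E y) → E 0 = 1 →
        ∀ x' : Fin N → K, expAEval E P' x' = 0 → ∃ x : Fin (N + 1) → K, expAEval E P x = 0 := by
  classical
  obtain ⟨p, hp⟩ : ∃ p, b p ≠ 0 := Function.ne_iff.1 hb
  by_cases hsingle : ∀ i, i ≠ p → b i = 0
  · -- a single non-zero coefficient: `a p = 0`
    have hap : a p = 0 := by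
      rw [Fintype.sum_eq_single p (fun i hi => by rw [hsingle i hi, Int.cast_zero, zero_mul])] at hrel
      rcases mul_eq_zero.1 hrel with h | h
      · exact absurd (by exact_mod_cast h) hp
      · exact h
    obtain ⟨hz, hlift⟩ := reduce_zero P ha p hap
    exact ⟨zeroPoly p P, hz, fun hadd h0 x' hx' => ⟨_, hlift h0 x' hx'⟩⟩
  · push Not at hsingle
    obtain ⟨q, hqp, hq⟩ := hsingle
    -- two non-zero coefficients `b p`, `b q`; arrange opposite signs, flipping `p` if needed
    -- general tool: the mixed case from any `p', q'` with `0 < b' p'`, `b' q' < 0`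
    have mixed : ∀ (P₁ : MvPolynomial (Fin (N + 1) ⊕ Fin (N + 1)) ℤ) (a₁ : Fin (N + 1) → ℝ)
        (b₁ : Fin (N + 1) → ℤ) (p₁ q₁ : Fin (N + 1)), expEval P₁ a₁ = 0 → 0 < b₁ p₁ → b₁ q₁ < 0 →
        ∑ i, (b₁ i : ℝ) * a₁ i = 0 →
        ∃ P' : MvPolynomial (Fin N ⊕ Fin N) ℤ, (∃ a' : Fin N → ℝ, expEval P' a' = 0) ∧
          ∀ {K : Type} [Field K] {E : K → K}, (∀ x y, E (x + y) = E x * E y) → E 0 = 1 →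
            ∀ x' : Fin N → K, expAEval E P' x' = 0 → ∃ x : Fin (N + 1) → K, expAEval E P₁ x = 0 := by
      intro P₁ a₁ b₁ p₁ q₁ ha₁ hp₁ hq₁ hrel₁
      obtain ⟨hz, hlift⟩ := reduce_mixed P₁ ha₁ b₁ hp₁ hq₁ hrel₁
      exact ⟨_, hz, fun hadd h0 x' hx' => ⟨_, hlift hadd h0 x' hx'⟩⟩
    -- the flip of coordinate `p`: new polynomial, zero and relation
    have flip : ∀ (b₁ : Fin (N + 1) → ℤ), ∑ i, (b₁ i : ℝ) * a i = 0 →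
        expEval (flipPoly p P) (Function.update a p (-a p)) = 0 ∧
          ∑ i, (Function.update b₁ p (-b₁ p) i : ℝ) * Function.update a p (-a p) i = 0 := by
      intro b₁ hrel₁
      constructor
      · rw [← expAEval_real, expAEval_flipPoly_eq_zero_iff Real.exp_add Real.exp_zero]
        have : Function.update (Function.update a p (-a p)) p (-Function.update a p (-a p) p) = a := by
          rw [Function.update_idem, Function.update_self, neg_neg, Function.update_eq_self]
        rw [this, expAEval_real, ha]
      · rw [← hrel₁, ← Finset.add_sum_erase _ _ (Finset.mem_univ p),
          ← Finset.add_sum_erase _ _ (Finset.mem_univ p)]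
        simp only [Function.update_self, Int.cast_neg, neg_mul_neg]
        congr 1
        exact Finset.sum_congr rfl fun i hi => by
          rw [Function.update_of_ne (Finset.ne_of_mem_erase hi), Function.update_of_ne (Finset.ne_of_mem_erase hi)]
    -- unflipping zeros in `K`
    have unflip : ∀ {K : Type} [Field K] {E : K → K}, (∀ x y, E (x + y) = E x * E y) → E 0 = 1 →
        ∀ x : Fin (N + 1) → K, expAEval E (flipPoly p P) x = 0 → ∃ y : Fin (N + 1) → K, expAEval E P y = 0 :=
      fun hadd h0 x hx => ⟨_, (expAEval_flipPoly_eq_zero_iff hadd h0 p P x).1 hx⟩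
    -- case analysis on the signs
    rcases lt_or_gt_of_ne hp with hpneg | hppos
    · rcases lt_or_gt_of_ne hq with hqneg | hqpos
      · -- both negative: flip `p`
        obtain ⟨hz, hrel'⟩ := flip b hrel
        have hp' : 0 < Function.update b p (-b p) p := by rw [Function.update_self]; linarith
        have hq' : Function.update b p (-b p) q < 0 := by rw [Function.update_of_ne hqp]; exact hqneg
        obtain ⟨P', hP', hliftK⟩ := mixed _ _ _ p q hz hp' hq' hrel'
        exact ⟨P', hP', fun hadd h0 x' hx' => by
          obtain ⟨x, hx⟩ := hliftK hadd h0 x' hx'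
          exact unflip hadd h0 x hx⟩
      · exact mixed P a b q p ha hqpos hpneg hrel
    · rcases lt_or_gt_of_ne hq with hqneg | hqpos
      · exact mixed P a b p q ha hppos hqneg hrel
      · -- both positive: flip `p`
        obtain ⟨hz, hrel'⟩ := flip b hrel
        have hp' : Function.update b p (-b p) p < 0 := by rw [Function.update_self]; linarith
        have hq' : 0 < Function.update b p (-b p) q := by rw [Function.update_of_ne hqp]; exact hqpos
        obtain ⟨P', hP', hliftK⟩ := mixed _ _ _ q p hz hq' hp' hrel'
        exact ⟨P', hP', fun hadd h0 x' hx' => by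
          obtain ⟨x, hx⟩ := hliftK hadd h0 x' hx'
          exact unflip hadd h0 x hx⟩

/-! ### The induction: zeros in all models of `mwTheory` -/

/-- **Zeros of flat exponential polynomials transfer to all models of `OEF ∪ NewtonScheme`**
(under SC, (B2), (B3)) — the heart of Macintyre–Wilkie §5 / Jones–Servi Thm. 3.11: for every
`P ∈ ℤ[x₁…x_N, y₁…y_N]` such that `x̄ ↦ P(x̄, e^{x̄})` has a real zero and every model `K` of
`mwTheory`, `P(γ̄, exp γ̄) = 0` for some `γ̄ ∈ Kᴺ`. [cite: JonesServi2011, Thm. 3.11 (proof)] -/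
theorem exists_zero_in_models (hB2 : Wilkie1996_flatDesingularisation)
    (hB3 : JonesServi2011_pointIdealGenerators) (hSC : SchanuelProperty ℝ) :
    ∀ (N : ℕ) (P : MvPolynomial (Fin N ⊕ Fin N) ℤ), (∃ x : Fin N → ℝ, expEval P x = 0) →
      ∀ K : Language.Theory.ModelType.{0, 0, 0} mwTheory,
        ∃ γ : Fin N → Theory.ModelType.toOEFModel modelsOEF_mwTheory K,
          expAEval OEFModel.exp P γ = 0 := by
  intro N
  induction N with
  | zero =>
    intro P hP K
    obtain ⟨c, rfl⟩ := MvPolynomial.C_surjective (Fin 0 ⊕ Fin 0) P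
    obtain ⟨x, hx⟩ := hP
    rw [expEval_C, Int.cast_eq_zero] at hx
    subst hx
    exact ⟨Fin.elim0, by simp [expAEval]⟩
  | succ N ih =>
    intro P hP K
    set K' := Theory.ModelType.toOEFModel modelsOEF_mwTheory K with hK'
    -- an exponentially-algebraic point on `V(P)`
    obtain ⟨f, a, hPa, hfa, hJ⟩ := flatDesingularisation_all hB2 (N + 1) P hP
    by_cases hli : LinearIndependent ℚ a
    · -- SC and the ideal of the point
      have hSCa : ((N + 1 : ℕ) : Cardinal) ≤
          Algebra.trdeg ℚ ↥(IntermediateField.adjoin ℚ (Set.range a ∪ Set.range (Real.exp ∘ a))) :=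
        hSC (N + 1) a hli
      obtain ⟨M, p₀, b, c, hM, hp₀, hidP, hidf⟩ :=
        exists_identities_of_pointIdealGenerators hB3 hSCa f P hfa hPa
      -- `M` is non-singular at `a`, the auxiliary system at `(a, p₀(a)⁻¹)`
      have hJM : (expJac M a).det ≠ 0 := det_expJac_ne_zero_of_identities hidf hfa hM hp₀ hJ
      have hns := isNonsingularZero_auxSystem M p₀ hM hp₀ hJM
      -- transfer to `K` through the code Newton sentence of the auxiliary system
      obtain ⟨x, hx⟩ := exists_zero_of_isNonsingularZero (N + 1 + 1)
        (List.ofFn fun i => ofMvPoly (N + 1 + 1) (auxSystem M p₀ i)) modelsOEF_mwTheory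
        (mwTheory_models_codeNewtonSentence _ _) hns K
      have hx' : ∀ i, expAEval OEFModel.exp (auxSystem M p₀ i) x = 0 := fun i => by
        rw [← expM_eq_exp, ← realize_rowTerm_ofMvPoly (auxSystem M p₀) Empty.elim x i]
        exact hx i
      exact ⟨x ∘ Fin.castSucc, expAEval_eq_zero_of_identity OEFModel.exp hidP hx'⟩
    · -- eliminate a variable and use the induction hypothesis
      obtain ⟨bz, hbz, hrel⟩ := exists_int_rel_of_not_linearIndependent hli
      obtain ⟨P', hP', hlift⟩ := reduce_dependent P hPa hbz hrel
      obtain ⟨γ', hγ'⟩ := ih P' hP' K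
      exact hlift OEFModel.exp_add OEFModel.exp_zero γ' hγ'

/-! ### From flat equations back to existential sentences -/

/-- The polynomial of a ring term in the variables `Empty ⊕ (Fin N ⊕ Fin N)`, as a polynomial in
`Fin N ⊕ Fin N`. [folklore] -/
def polyOfTerm {N : ℕ} (p : Language.orderedRing.Term (Empty ⊕ (Fin N ⊕ Fin N))) :
    MvPolynomial (Fin N ⊕ Fin N) ℤ :=
  MvPolynomial.rename (Sum.elim Empty.elim id) (Language.orderedRing.termToMvPoly p)

/-- **Ring terms at `(x̄, exp x̄)` in a model of `OEF` are values of their polynomial.** [folklore] -/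
theorem realize_env_eq_expAEval {N : ℕ} (K : Language.Theory.ModelType.{0, 0, 0} Theory.OEF)
    (p : Language.orderedRing.Term (Empty ⊕ (Fin N ⊕ Fin N))) (y : Fin N → K) :
    p.realize (OEFModel.env (default : Empty → K) y) = expAEval OEFModel.exp (polyOfTerm p) y := by
  rw [Language.orderedRing.realize_eq_aeval_termToMvPoly, expAEval, polyOfTerm, MvPolynomial.aeval_rename]
  have : (OEFModel.env (default : Empty → K) y : Empty ⊕ (Fin N ⊕ Fin N) → K) =
      (Sum.elim y (OEFModel.exp ∘ y)) ∘ (Sum.elim Empty.elim id) := by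
    funext v
    rcases v with e | v
    · exact e.elim
    · rcases v with i | i <;> rfl
  rw [this]

/-- **Ring terms at `(x̄, e^{x̄})` in `ℝ` are values of their polynomial** (`ExpPoly.expEval`). [folklore] -/
theorem realize_real_eq_expEval {N : ℕ} (p : Language.orderedRing.Term (Empty ⊕ (Fin N ⊕ Fin N)))
    (y : Fin N → ℝ) :
    p.realize (Sum.elim (default : Empty → ℝ) (Sum.elim y (Real.exp ∘ y))) = expEval (polyOfTerm p) y := by
  rw [Language.orderedRing.realize_eq_aeval_termToMvPoly, expEval, polyOfTerm, MvPolynomial.aeval_rename]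
  have : (Sum.elim (default : Empty → ℝ) (Sum.elim y (Real.exp ∘ y)) : Empty ⊕ (Fin N ⊕ Fin N) → ℝ) =
      (expPt y) ∘ (Sum.elim Empty.elim id) := by
    funext v
    rcases v with e | v
    · exact e.elim
    · rcases v with i | i <;> rfl
  rw [this]

/-- **`mwTheory` proves every true existential sentence** (under SC, (B2), (B3)): by (B5) the
sentence is, uniformly in the models of `OEF`, the solvability of one flat equation
`P(x̄, e^{x̄}) = 0`; it is solvable in `ℝ`, hence (by `exists_zero_in_models`) in every model of
`mwTheory`. [cite: JonesServi2011, Thm. 3.11 (proof)] -/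
theorem mwTheory_models_of_mem (hB2 : Wilkie1996_flatDesingularisation)
    (hB3 : JonesServi2011_pointIdealGenerators) (hSC : SchanuelProperty ℝ)
    {φ : Language.orderedExpRing.Sentence} (hφ : φ ∈ realExpExistentialTheory) : mwTheory ⊨ᵇ φ := by
  obtain ⟨hex, hR⟩ := mem_realExpExistentialTheory_iff.1 hφ
  obtain ⟨N, p, hp⟩ := OEFModel.realize_iff_expPoly_of_isExistential.{0} hex
  -- the real zero
  have hRm : (Language.Theory.ModelType.of Theory.OEF ℝ) ⊨ φ := hR
  obtain ⟨y, hy⟩ := (hp (Language.Theory.ModelType.of Theory.OEF ℝ)).1 hRm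
  have hreal : ∃ x : Fin N → ℝ, expEval (polyOfTerm p) x = 0 := by
    refine ⟨y, ?_⟩
    rw [← realize_real_eq_expEval]
    have henv : (Sum.elim (default : Empty → ℝ) (Sum.elim y (Real.exp ∘ y)) : Empty ⊕ (Fin N ⊕ Fin N) → ℝ) =
        OEFModel.env (K := Language.Theory.ModelType.of Theory.OEF ℝ) default y := by
      funext v
      rcases v with e | v
      · exact e.elim
      · rcases v with i | i <;> rfl
    rw [henv]
    convert hy using 2
    all_goals rfl
  -- every model of `mwTheory`
  refine Language.Theory.models_sentence_iff.2 fun K => ?_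
  obtain ⟨γ, hγ⟩ := exists_zero_in_models hB2 hB3 hSC N (polyOfTerm p) hreal K
  have hK : (Theory.ModelType.toOEFModel modelsOEF_mwTheory K) ⊨ φ :=
    (hp _).2 ⟨γ, by rw [realize_env_eq_expAEval]; exact hγ⟩
  exact hK

/-! ### The conditional half, and Macintyre–Wilkie's theorem, from the leaves -/

/-- **`Th_∃(ℝ_exp)` is r.e. under SC**, from (B2), (B3), (B4). [cite: MacintyreWilkieKreiseliana1996, Thm. 1.1 (conditional half), §5] -/
theorem realExpExistentialTheory_isREAxioms_of_leaves (hB2 : Wilkie1996_flatDesingularisation)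
    (hB3 : JonesServi2011_pointIdealGenerators) (hB4 : newtonScheme.IsREAxioms)
    (hSC : SchanuelProperty ℝ) : realExpExistentialTheory.IsREAxioms :=
  realExpExistentialTheory_isREAxioms_of_union OEF_subset_realExpTheory OEF_isRecursive
    newtonScheme_subset_realExpTheory hB4 fun _ hφ => mwTheory_models_of_mem hB2 hB3 hSC hφ

/-- **The conditional half of Macintyre–Wilkie's Theorem 1.1 from its leaves**:
`(B2) → (B3) → (B4) → (SC_ℝ ⟹ Th_∃(ℝ_exp) computably axiomatizable, i.e. r.e.)` — the
decidability of `Th(ℝ_exp)` itself needs the unconditional half (A0) as well. [cite: MacintyreWilkieKreiseliana1996, Thm. 1.1 (conditional half), §5] -/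
theorem macintyreWilkie_existential_of_leaves (hB2 : Wilkie1996_flatDesingularisation)
    (hB3 : JonesServi2011_pointIdealGenerators) (hB4 : newtonScheme.IsREAxioms) :
    macintyreWilkie_existential_of_schanuelProperty :=
  macintyreWilkie_existential_of_schanuelProperty_of_models fun hSC =>
    ⟨mwTheory, mwTheory_subset_realExpTheory, OEF_isRecursive.isREAxioms.union hB4,
      fun _ hφ => mwTheory_models_of_mem hB2 hB3 hSC hφ⟩

/-- **Macintyre–Wilkie's Theorem 1.1 from its leaves**: the unconditional half (A0)
`macintyreWilkie_recursiveSubtheory` and (B2), (B3), (B4) give `macintyre_wilkie`. [cite: MacintyreWilkieKreiseliana1996, Thm. 1.1] -/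
theorem macintyre_wilkie_of_leaves (hA : macintyreWilkie_recursiveSubtheory)
    (hB2 : Wilkie1996_flatDesingularisation) (hB3 : JonesServi2011_pointIdealGenerators)
    (hB4 : newtonScheme.IsREAxioms) : macintyre_wilkie :=
  macintyre_wilkie_of_recursiveSubtheory_of_reModels hA fun hSC =>
    ⟨mwTheory, mwTheory_subset_realExpTheory, OEF_isRecursive.isREAxioms.union hB4,
      fun _ hφ => mwTheory_models_of_mem hB2 hB3 hSC hφ⟩

/-- **The conditional half of Macintyre–Wilkie's Theorem 1.1 from the two cited facts** (B2)
(Wilkie's desingularisation) and (B3) (Jones–Servi's Prop. 3.8 at the point), the r.e.-ness of the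
Newton scheme (B4) being proved in `CodeNewtonLetters.lean`. [cite: MacintyreWilkieKreiseliana1996, Thm. 1.1 (conditional half), §5] -/
theorem macintyreWilkie_existential_of_facts (hB2 : Wilkie1996_flatDesingularisation)
    (hB3 : JonesServi2011_pointIdealGenerators) : macintyreWilkie_existential_of_schanuelProperty :=
  macintyreWilkie_existential_of_leaves hB2 hB3 newtonScheme_isREAxioms

/-- **The conditional half of Macintyre–Wilkie's Theorem 1.1 from Wilkie's desingularisation
theorem alone** ((B3) being proved in `PointIdealGeneratorsProofs.lean`, (B4) in
`CodeNewtonLetters.lean`): `SC_ℝ ⟹ Th_∃(ℝ_exp)` is computably axiomatizable (r.e.), granted the named fact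
`Wilkie1996_flatDesingularisation`. [cite: MacintyreWilkieKreiseliana1996, Thm. 1.1 (conditional half), §5] -/
theorem macintyreWilkie_existential_of_desingularisation (hB2 : Wilkie1996_flatDesingularisation) :
    macintyreWilkie_existential_of_schanuelProperty :=
  macintyreWilkie_existential_of_facts hB2 JonesServi2011_pointIdealGenerators_holds

/-- **Macintyre–Wilkie's Theorem 1.1 from (A0), (B2), (B3).** [cite: MacintyreWilkieKreiseliana1996, Thm. 1.1] -/
theorem macintyre_wilkie_of_facts (hA : macintyreWilkie_recursiveSubtheory)
    (hB2 : Wilkie1996_flatDesingularisation) (hB3 : JonesServi2011_pointIdealGenerators) : macintyre_wilkie :=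
  macintyre_wilkie_of_leaves hA hB2 hB3 newtonScheme_isREAxioms

/-- **Macintyre–Wilkie's Theorem 1.1 from its unconditional half (A0) and Wilkie's
desingularisation theorem (B2).** [cite: MacintyreWilkieKreiseliana1996, Thm. 1.1] -/
theorem macintyre_wilkie_of_desingularisation (hA : macintyreWilkie_recursiveSubtheory)
    (hB2 : Wilkie1996_flatDesingularisation) : macintyre_wilkie :=
  macintyre_wilkie_of_facts hA hB2 JonesServi2011_pointIdealGenerators_holds

end Literature.ModelTheory.ExponentialFields

end
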